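import Mathlib
import Literature.MathematicalPhysics.QuantumFieldTheory.BalabanImbrieJaffe1984to88.BIJ85Eq7112FibreMinReal

/-!
# `BalabanImbrieJaffe1984to88.BIJ85Eq7117FibreMinFree` — T. Bałaban, J. Imbrie, A. Jaffe, *Renormalization of the Higgs model:
minimizers, propagators and the stability of mean field theory*, Commun. Math. Phys. **97** (1985) 299–329 [BalabanImbrieJaffe1985]:
Sect. 7.1 p. 323 (7.1.17) `τ₁ = Q^e_k(I − P_∂)Q^{e*}_k` — **THE UNCONSTRAINED FIBRE MINIMUM**: `τ₁` is the part of σ_k obtained by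
minimising the exponent `‖∂A − Q^{e*}_kf‖²` of (4.2.1) over ALL η-bond fields `A` (`P_∂` = *"the orthogonal projection onto curls"*; seat
p33's `BIJ85Tau1Config717.inner_tau1Torus_eq_iInf`), so its momentum symbol is governed by the UNCONSTRAINED fibre minimum
`m°_{p′}(φ) = inf_α E_{p′}(α, φ)` of gen 5's fibre energy; this file is the `Tor`-carrier half: **`inf_A ‖∂^ηA − Q^{e*}_kf‖²_η = Σ_{p′}
m°_{p′}(f̂(p′))`** (every block size `n`), `m° ≤ m` (the constrained minimum of file `BIJ85Eq7112FibreMin`: *"0 ≤ τ₁ ≤ σ_k"*), and the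
real/imaginary splitting of the unconstrained infimum — file 1 of 3 of the SEPARATE identification of τ₁ ((7.1.17) ↔ (7.1.14)) and τ₂
((7.1.15)) for the operators of record (file 2 `BIJ85Eq7117Tau1Symbol`: the symbol of p33's `tau1Torus` IS `½·m°_{p′}`; file 3
`BIJ85Eq7114Tau1Identification`: `= τ₁(p′)` of (7.1.14) at generic momenta, τ₂ by difference)

statement-level skeleton of published theorems with citation tags; proofs where landed; nothing here is a claim about
the Yang–Mills mass gap

PDF held: `paper:balaban1985-cmp97-bij-higgs-minimizers` (journal page = PDF page + 298).  Text read as images: PDF pp. 24–25 (journal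
322–323; `run/shared/lean/pub/pub-balaban/t4/b2b-balaban-t4-lit2/renders/bij1985/1985-cmp97-bij-higgs-minimizers-p024-x2.png`, `…-p025-x2.png`).

THE PRINTED TEXT (verbatim, p. 323).  *"The fact that τ₁ vanishes on curls can be established as follows: The general form of τ₁ in
configuration space is evident from (7.1.11), (7.1.14) namely τ₁ = Q^e_k(I − P_∂)Q^{e*}_k, (7.1.17) where P_∂ denotes the orthogonal
projection onto curls."*

CITATION HEADER (lean-in-tree rule).  Part of the lit-balaban TYPED SKELETON (HOME `run/shared/lean/pub/lit-balaban/`), Phase-2 seat p27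
(gen 6), unit `lit-balaban-p27`; rows **C1.Eq7.1.13-7.1.19**, **C1.Eq7.1.2-7.1.12** of `HOME/SKELETON.md` (owner r15, referee ref-5) — p33's
`BIJ85Tau1Config717` scope note *"the identification of this τ₂'s momentum symbol with (7.1.15) is … not claimed"*.  Builds on gen 5's
`BIJ85Eq7112FibreEnergy` and this generation's `BIJ85Eq7112FibreMin` / `BIJ85Eq7112FibreMinReal` (`fibreMin`, `energy421`, `assemble`,
`reP`/`imP`, `energy421_eq_reP_add_imP`), consumed by name.
WHAT IS KERNEL-CHECKED (zero `sorry`, standard axioms; one object DEFINED with a body — `fibreMinU`; no `def … : Prop`, no new named fact,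
D-0026): §1 `fibreMinU` with `fibreMinU_le`, `le_fibreMinU_iff`, `exists_fibreEnergy_lt_free`, `fibreMinU_zero`, **`fibreMinU_le_fibreMin`**;
§2 `sum_fibreMinU_le_energy421` (EVERY `A`), `exists_energy421_lt_free`, **`iInf_energy421_eq_sum_fibreMinU`**, `le_sum_fibreMinU_iff`;
§3 `energy421_reP_le_free`, **`iInf_energy421_eq_reP_add_imP_free`**.  NOT CLAIMED here: the `Setup` side (file 2), the closed form (file 3).
-/

namespace Literature.MathematicalPhysics.QuantumFieldTheory.BalabanImbrieJaffe1984to88.BIJ85Eq7117FibreMinFree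

open scoped BigOperators Matrix ComplexConjugate
open Literature.MathematicalPhysics.QuantumFieldTheory.Balaban1983to89
open Literature.MathematicalPhysics.QuantumFieldTheory.Balaban1983to89.B5Prop11Plancherel
open Literature.MathematicalPhysics.QuantumFieldTheory.Balaban1983to89.B5Block118
open Literature.MathematicalPhysics.QuantumFieldTheory.BalabanImbrieJaffe1984to88.BIJ85Eq712Plancherel
open Literature.MathematicalPhysics.QuantumFieldTheory.BalabanImbrieJaffe1984to88.BIJ85Eq715ConfigSymbols
open Literature.MathematicalPhysics.QuantumFieldTheory.BalabanImbrieJaffe1984to88.BIJ85Eq7111CrossSymbols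
open Literature.MathematicalPhysics.QuantumFieldTheory.BalabanImbrieJaffe1984to88.BIJ85Eq7111EdgeAdjoint
open Literature.MathematicalPhysics.QuantumFieldTheory.BalabanImbrieJaffe1984to88.BIJ85Eq7112FibreEnergy
open Literature.MathematicalPhysics.QuantumFieldTheory.BalabanImbrieJaffe1984to88.BIJ85Eq7112FibreMin
open Literature.MathematicalPhysics.QuantumFieldTheory.BalabanImbrieJaffe1984to88.BIJ85Eq7112FibreMinReal

noncomputable section

variable {d : ℕ} (n : ℕ) [NeZero n] (M : Fin d → ℕ) [hM : ∀ μ, NeZero (M μ)]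

/-! ## §1 The unconstrained fibre minimum `m°_{p′}(φ) = inf_α E_{p′}(α, φ)` -/

section FibreMinU

/-- **THE UNCONSTRAINED FIBRE MINIMUM at the unit momentum `p′`**: `m°_{p′}(φ) = inf {E_{p′}(α, φ) : α any fibre family}` — the fibre
of the minimisation over ALL η-bond fields behind (7.1.17) `τ₁ = Q^e_k(I − P_∂)Q^{e*}_k` (files 2–3: `⟨φ, τ₁(p′)φ⟩ = ½·m°_{p′}(φ^asym)`).
[cite: BalabanImbrieJaffe1985, (7.1.17) p.323] -/
def fibreMinU (q : Tor M) (φ : Fin d × Fin d → ℂ) : ℝ :=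
  ⨅ α : (Fin d → Fin n) → Fin d → ℂ, fibreEnergy n M q α φ

omit hM in
/-- kernel: fibre energies are bounded below (by zero). [folklore] -/
private theorem bddBelow_free (q : Tor M) (φ : Fin d × Fin d → ℂ) :
    BddBelow (Set.range fun α : (Fin d → Fin n) → Fin d → ℂ => fibreEnergy n M q α φ) := by
  refine ⟨0, ?_⟩
  rintro _ ⟨α, rfl⟩
  exact fibreEnergy_nonneg n M q α φ

omit hM in
/-- `m°_{p′}(φ) ≤ E_{p′}(α, φ)` for EVERY fibre family `α`. [cite: BalabanImbrieJaffe1985, (7.1.17) p.323] -/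
theorem fibreMinU_le (q : Tor M) (α : (Fin d → Fin n) → Fin d → ℂ) (φ : Fin d × Fin d → ℂ) :
    fibreMinU n M q φ ≤ fibreEnergy n M q α φ :=
  ciInf_le (bddBelow_free n M q φ) α

omit hM in
/-- Transfer of lower bounds: `a ≤ m°_{p′}(φ)` iff `a ≤ E_{p′}(α, φ)` for every `α`. [cite: BalabanImbrieJaffe1985, (7.1.17) p.323] -/
theorem le_fibreMinU_iff {q : Tor M} {φ : Fin d × Fin d → ℂ} {a : ℝ} :
    a ≤ fibreMinU n M q φ ↔ ∀ α : (Fin d → Fin n) → Fin d → ℂ, a ≤ fibreEnergy n M q α φ :=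
  ⟨fun h α => h.trans (fibreMinU_le n M q α φ), fun h => le_ciInf h⟩

omit hM in
/-- `0 ≤ m°_{p′}(φ)`. [cite: BalabanImbrieJaffe1985, (7.1.17) p.323] -/
theorem fibreMinU_nonneg (q : Tor M) (φ : Fin d × Fin d → ℂ) : 0 ≤ fibreMinU n M q φ :=
  (le_fibreMinU_iff n M).2 fun α => fibreEnergy_nonneg n M q α φ

omit hM in
/-- Near-minimisers: for every `ε > 0` some `α` has `E_{p′}(α, φ) < m°_{p′}(φ) + ε`. [cite: BalabanImbrieJaffe1985, (7.1.17) p.323] -/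
theorem exists_fibreEnergy_lt_free (q : Tor M) (φ : Fin d × Fin d → ℂ) {ε : ℝ} (hε : 0 < ε) :
    ∃ α : (Fin d → Fin n) → Fin d → ℂ, fibreEnergy n M q α φ < fibreMinU n M q φ + ε :=
  exists_lt_of_ciInf_lt (lt_add_of_pos_right (fibreMinU n M q φ) hε)

omit hM in
/-- `m°_{p′}(0) = 0`. [cite: BalabanImbrieJaffe1985, (7.1.17) p.323] -/
theorem fibreMinU_zero (q : Tor M) : fibreMinU n M q 0 = 0 :=
  le_antisymm ((fibreMinU_le n M q (fun _ _ => 0) 0).trans_eq (fibreEnergy_zero_zero n M q)) (fibreMinU_nonneg n M q 0)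

omit hM in
/-- **`m° ≤ m`**: the unconstrained fibre minimum is below the constrained one (*"0 ≤ τ₁ ≤ σ_k"*, the fibre form of p33's
`inner_tau1Torus_le_inner_sigmaTorus`). [cite: BalabanImbrieJaffe1985, (7.1.25) p.324] -/
theorem fibreMinU_le_fibreMin (q : Tor M) (φ : Fin d × Fin d → ℂ) : fibreMinU n M q φ ≤ fibreMin n M q φ :=
  (le_fibreMin_iff n M).2 fun α _ => fibreMinU_le n M q α φ

end FibreMinU

/-! ## §2 The unconstrained infimum of the exponent of (4.2.1) splits over the unit momenta -/

section Energy

/-- **Every `A` pays at least the sum of the unconstrained fibre minima**: `Σ_{p′} m°_{p′}(f̂(p′)) ≤ ‖∂^ηA − Q^{e*}_kf‖²_η`.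
[cite: BalabanImbrieJaffe1985, (7.1.17) p.323] -/
theorem sum_fibreMinU_le_energy421 (A : Tor (fine n M) × Fin d → ℂ) (f : Tor M × (Fin d × Fin d) → ℂ) :
    ∑ q : Tor M, fibreMinU n M q (fun a => (dftC M (Fin d × Fin d) *ᵥ f) (q, a)) ≤ energy421 n M A f := by
  rw [energy421_eq_sum_fibreEnergy]
  exact Finset.sum_le_sum fun q _ => fibreMinU_le n M q _ _

/-- **Near-minimisers in configuration space**: for every `ε > 0` there is an η-bond field `A` with
`‖∂^ηA − Q^{e*}_kf‖²_η < Σ_{p′} m°_{p′}(f̂(p′)) + ε`. [cite: BalabanImbrieJaffe1985, (7.1.17) p.323] -/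
theorem exists_energy421_lt_free (f : Tor M × (Fin d × Fin d) → ℂ) {ε : ℝ} (hε : 0 < ε) :
    ∃ A : Tor (fine n M) × Fin d → ℂ,
      energy421 n M A f < ∑ q : Tor M, fibreMinU n M q (fun a => (dftC M (Fin d × Fin d) *ᵥ f) (q, a)) + ε := by
  have hcard : (0 : ℝ) < Fintype.card (Tor M) := Nat.cast_pos.2 Fintype.card_pos
  have hδ : 0 < ε / Fintype.card (Tor M) := div_pos hε hcard
  have hex : ∀ q : Tor M, ∃ α : (Fin d → Fin n) → Fin d → ℂ,
      fibreEnergy n M q α (fun a => (dftC M (Fin d × Fin d) *ᵥ f) (q, a))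
        < fibreMinU n M q (fun a => (dftC M (Fin d × Fin d) *ᵥ f) (q, a)) + ε / Fintype.card (Tor M) := fun q =>
    exists_fibreEnergy_lt_free n M q (fun a => (dftC M (Fin d × Fin d) *ᵥ f) (q, a)) hδ
  choose α hαlt using hex
  refine ⟨assemble n M α, ?_⟩
  rw [energy421_assemble]
  calc ∑ q : Tor M, fibreEnergy n M q (α q) (fun a => (dftC M (Fin d × Fin d) *ᵥ f) (q, a))
      < ∑ q : Tor M, (fibreMinU n M q (fun a => (dftC M (Fin d × Fin d) *ᵥ f) (q, a)) + ε / Fintype.card (Tor M)) :=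
        Finset.sum_lt_sum_of_nonempty Finset.univ_nonempty fun q _ => hαlt q
    _ = ∑ q : Tor M, fibreMinU n M q (fun a => (dftC M (Fin d × Fin d) *ᵥ f) (q, a)) + ε := by
        rw [Finset.sum_add_distrib, Finset.sum_const, Finset.card_univ, nsmul_eq_mul, mul_div_cancel₀ _ hcard.ne']

/-- kernel: unconstrained energies are bounded below (by zero). [folklore] -/
private theorem bddBelow_A (f : Tor M × (Fin d × Fin d) → ℂ) :
    BddBelow (Set.range fun A : Tor (fine n M) × Fin d → ℂ => energy421 n M A f) := by
  refine ⟨0, ?_⟩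
  rintro _ ⟨A, rfl⟩
  exact energy421_nonneg n M A f

/-- `inf_A ‖∂^ηA − Q^{e*}_kf‖²_η ≤ ‖∂^ηA − Q^{e*}_kf‖²_η`. [cite: BalabanImbrieJaffe1985, (7.1.17) p.323] -/
theorem iInf_energy421_le_free (A : Tor (fine n M) × Fin d → ℂ) (f : Tor M × (Fin d × Fin d) → ℂ) :
    (⨅ B : Tor (fine n M) × Fin d → ℂ, energy421 n M B f) ≤ energy421 n M A f :=
  ciInf_le (bddBelow_A n M f) A

/-- **THE UNCONSTRAINED INFIMUM SPLITS OVER THE UNIT MOMENTA**: `inf_A ‖∂^ηA − Q^{e*}_kf‖²_η = Σ_{p′} m°_{p′}(f̂(p′))` over ALL η-bond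
fields `A` — the variational form of the multiplication operator `τ₁(p)` of (7.1.14)/(7.1.17), every block size `n`, every torus.
[cite: BalabanImbrieJaffe1985, (7.1.17) p.323] -/
theorem iInf_energy421_eq_sum_fibreMinU (f : Tor M × (Fin d × Fin d) → ℂ) :
    (⨅ A : Tor (fine n M) × Fin d → ℂ, energy421 n M A f)
      = ∑ q : Tor M, fibreMinU n M q (fun a => (dftC M (Fin d × Fin d) *ᵥ f) (q, a)) := by
  refine le_antisymm (le_of_forall_pos_lt_add fun ε hε => ?_) (le_ciInf fun A => sum_fibreMinU_le_energy421 n M A f)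
  obtain ⟨A, hlt⟩ := exists_energy421_lt_free n M f hε
  exact (iInf_energy421_le_free n M A f).trans_lt hlt

/-- Transfer of lower bounds: `a ≤ Σ_{p′} m°_{p′}(f̂(p′))` iff `a ≤ ‖∂^ηA − Q^{e*}_kf‖²_η` for every `A`. [cite: BalabanImbrieJaffe1985, (7.1.17) p.323] -/
theorem le_sum_fibreMinU_iff (f : Tor M × (Fin d × Fin d) → ℂ) (a : ℝ) :
    a ≤ ∑ q : Tor M, fibreMinU n M q (fun a => (dftC M (Fin d × Fin d) *ᵥ f) (q, a)) ↔
      ∀ A : Tor (fine n M) × Fin d → ℂ, a ≤ energy421 n M A f := by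
  rw [← iInf_energy421_eq_sum_fibreMinU]
  exact ⟨fun h A => h.trans (iInf_energy421_le_free n M A f), fun h => le_ciInf h⟩

/-- **`inf_A ≤ inf_{Q_kA=0}`** in configuration space (`0 ≤ τ₁ ≤ σ_k` for the forms). [cite: BalabanImbrieJaffe1985, (7.1.25) p.324] -/
theorem iInf_energy421_free_le_constrained (f : Tor M × (Fin d × Fin d) → ℂ) :
    (⨅ A : Tor (fine n M) × Fin d → ℂ, energy421 n M A f)
      ≤ ⨅ B : {A : Tor (fine n M) × Fin d → ℂ // QvOp n M *ᵥ A = 0}, energy421 n M B.1 f := by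
  rw [iInf_energy421_eq_sum_fibreMinU, iInf_energy421_eq_sum_fibreMin]
  exact Finset.sum_le_sum fun q _ => fibreMinU_le_fibreMin n M q _

end Energy

/-! ## §3 Real and imaginary parts (the operators are real, file `BIJ85Eq7112FibreMinReal`) -/

section Real

/-- For a REAL two-form `F`, discarding `Im A` does not raise the exponent (file 2's `energy421_reP_le`, restated for use here).
[cite: BalabanImbrieJaffe1985, (4.2.1) p.310] -/
theorem energy421_reP_le_free (A : Tor (fine n M) × Fin d → ℂ) {F : Tor M × (Fin d × Fin d) → ℂ} (hF : reP F = F) :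
    energy421 n M (reP A) F ≤ energy421 n M A F :=
  energy421_reP_le n M A hF

omit hM in
/-- kernel: `Re(Re g) = Re g`. [folklore] -/
private theorem reP_reP' {ι : Type*} (g : ι → ℂ) : reP (reP g) = reP g := by
  funext i; simp

omit hM in
/-- kernel: `Re(Im g) = Im g`. [folklore] -/
private theorem reP_imP' {ι : Type*} (g : ι → ℂ) : reP (imP g) = imP g := by
  funext i; simp

omit hM in
/-- kernel: real and imaginary parts of `Re B + i·Re C`. [folklore] -/
private theorem reP_imP_combine' {ι : Type*} (B C : ι → ℂ) :
    reP (reP B + Complex.I • reP C) = reP B ∧ imP (reP B + Complex.I • reP C) = reP C := by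
  constructor <;> funext i <;> simp

/-- **THE UNCONSTRAINED INFIMUM SPLITS INTO REAL AND IMAGINARY PARTS**: for every complex unit two-form `F`,
`inf_A E(A, F) = inf_A E(A, Re F) + inf_A E(A, Im F)`. [cite: BalabanImbrieJaffe1985, (7.1.17) p.323] -/
theorem iInf_energy421_eq_reP_add_imP_free (F : Tor M × (Fin d × Fin d) → ℂ) :
    (⨅ A : Tor (fine n M) × Fin d → ℂ, energy421 n M A F)
      = (⨅ A : Tor (fine n M) × Fin d → ℂ, energy421 n M A (reP F))
        + ⨅ A : Tor (fine n M) × Fin d → ℂ, energy421 n M A (imP F) := by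
  apply le_antisymm
  · refine le_of_forall_pos_lt_add fun ε hε => ?_
    have hε2 : 0 < ε / 2 := by positivity
    obtain ⟨B, hB⟩ := exists_lt_of_ciInf_lt (lt_add_of_pos_right
      (⨅ A : Tor (fine n M) × Fin d → ℂ, energy421 n M A (reP F)) hε2)
    obtain ⟨C, hC⟩ := exists_lt_of_ciInf_lt (lt_add_of_pos_right
      (⨅ A : Tor (fine n M) × Fin d → ℂ, energy421 n M A (imP F)) hε2)
    have hB' : energy421 n M (reP B) (reP F) < _ := (energy421_reP_le n M B (reP_reP' F)).trans_lt hB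
    have hC' : energy421 n M (reP C) (imP F) < _ := (energy421_reP_le n M C (reP_imP' F)).trans_lt hC
    set A : Tor (fine n M) × Fin d → ℂ := reP B + Complex.I • reP C with hAdef
    have hE : energy421 n M A F = energy421 n M (reP B) (reP F) + energy421 n M (reP C) (imP F) := by
      rw [energy421_eq_reP_add_imP, (reP_imP_combine' B C).1, (reP_imP_combine' B C).2]
    calc (⨅ A : Tor (fine n M) × Fin d → ℂ, energy421 n M A F) ≤ energy421 n M A F := iInf_energy421_le_free n M A F
      _ < _ := by rw [hE]; linarith
  · refine le_ciInf fun A => ?_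
    rw [energy421_eq_reP_add_imP]
    exact add_le_add (iInf_energy421_le_free n M _ _) (iInf_energy421_le_free n M _ _)

end Real

end

end Literature.MathematicalPhysics.QuantumFieldTheory.BalabanImbrieJaffe1984to88.BIJ85Eq7117FibreMinFree
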